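import Mathlib
import Literature.MathematicalPhysics.StatisticalMechanics.PeriodicConfigurationSums
import Literature.MathematicalPhysics.StatisticalMechanics.LennardJonesClusters
import Summits.AtomisticToContinuum.Crystallization.Theorems.ThreeConeCertificateExactCertificateTransfer1DPeriodicPosType
import Summits.AtomisticToContinuum.Crystallization.Theorems.ThreeConeCertificateExactCertificateTransfer1DCesaro

/-!
# Crux `ExactCertificate` (stmt-AtomisticToContinuum-11959), line `closure-makes-nogap-exact`,
# Transfer skeleton VI (`UniquePeriodicMinimiser1D`): stub `stub_blockEnergy1D`

Support file (`--supports stmt-AtomisticToContinuum-11959`); nothing here closes the 3-D crux.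

BLOCKS ARE TRIAL STATES WITH `o(K)` SURFACE ENERGY.  For a periodic configuration `Q = F + ℤv` of the
line (`Q.lattice = ℤv`) the block of `K` cells is the configuration of the `#F·K` points `y + j v`,
`y ∈ F`, `0 ≤ j < K`, indexed through `Fin (#F·K) ≃ Fin #F × Fin K` (`finProdFinEquiv`) and
`F ≃ Fin #F` (`Finset.equivFin`).  Its Lennard-Jones energy is `#F·K·e_LJ(Q) + o(K)`:

  `(E_LJ(block_K) − #F·K·e_LJ(Q)) / K → 0`  as `K → ∞`.

Proof (the computation inside `stub_periodicPosType1D`, file `…Transfer1DPeriodicPosType.lean`, with the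
limit extracted instead of its sign): `2·E(block_K) = Σ_{i,j} V(|p_i − p_j|)` (`V_LJ(0) = 0`,
`two_mul_interactionEnergy_eq_sum_sum`) `= Σ_{x,y ∈ F} Σ_{i,j<K} V(|x − y − (j − i)v|) = Σ_{d<K}(K − d)·e_d`
(`ppos_counting`), where `Σ_d e_d` converges absolutely (`PeriodicConfiguration.summable_lennardJones_dist`)
with sum `Σ_{x ∈ F} (V(0) + S_Q(x)) = 2·#F·e(Q)`; the Fejér means `(Σ_{d<K}(K − d)e_d)/K` tend to `Σ_d e_d`
(`stub_cesaro`).  Helper lemmas are prefixed `ublockE_`.  All `[folklore]`.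
-/

noncomputable section

namespace Summit.AtomisticToContinuum.Crystallization.Theorems.ThreeConeCertificateExactCertificate.Transfer1D

open Literature.MathematicalPhysics.StatisticalMechanics MeasureTheory Set Filter Topology
open scoped BigOperators

/-- Fejér limit of the unit-weight Gram sums of a radial kernel `f` over the blocks
`{y + j v : y ∈ F, j < K}` of a periodic configuration `Q = F + ℤv` of the line:
`(Σ_{q,q' ∈ F × [0,K)} f(|q − q'|)) / K → #F·f(0) + Σ_{x ∈ F} Σ'_{z ∈ Q, z ≠ x} f(|x − z|)`, provided the site
sums are summable (Gram sum `= Σ_{d<K}(K − d)e_d` by `ppos_counting`, Fejér means by `stub_cesaro`).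
[folklore] -/
theorem ublockE_gram_tendsto (Q : PeriodicConfiguration 1) (f : ℝ → ℝ) {v : EuclideanSpace ℝ (Fin 1)}
    (hvne : v ≠ 0) (hmem : ∀ g : EuclideanSpace ℝ (Fin 1), g ∈ Q.lattice ↔ ∃ n : ℤ, g = (n : ℝ) • v)
    (hsum : ∀ y : EuclideanSpace ℝ (Fin 1), y ∈ Q.points →
      Summable (fun z : {z : EuclideanSpace ℝ (Fin 1) // z ∈ Q.points ∧ z ≠ y} => f (dist y z.1))) :
    Filter.Tendsto (fun K : ℕ => (∑ q : Q.motif × Fin K, ∑ q' : Q.motif × Fin K,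
        f (dist (q.1.1 + ((q.2 : ℕ) : ℝ) • v) (q'.1.1 + ((q'.2 : ℕ) : ℝ) • v))) / K) Filter.atTop
      (nhds ((Q.motif.card : ℝ) * f 0 + ∑ x ∈ Q.motif,
        ∑' z : {z : EuclideanSpace ℝ (Fin 1) // z ∈ Q.points ∧ z ≠ x}, f (dist x z.1))) := by
  haveI : DecidableEq (Q.motif × ℤ) := Classical.decEq _
  -- uniqueness of the representation `y + n v`
  have huniq : ∀ y ∈ Q.motif, ∀ y' ∈ Q.motif, ∀ n n' : ℤ,
      y + (n : ℝ) • v = y' + (n' : ℝ) • v → y = y' ∧ n = n' := by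
    intro y hy y' hy' n n' h
    have hsub : y - y' = ((n' - n : ℤ) : ℝ) • v := by
      calc y - y' = (y + (n : ℝ) • v) - (n : ℝ) • v - y' := by abel
        _ = (y' + (n' : ℝ) • v) - (n : ℝ) • v - y' := by rw [h]
        _ = ((n' - n : ℤ) : ℝ) • v := by rw [Int.cast_sub, sub_smul]; abel
    have hyy : y = y' := Q.eq_of_sub_mem y hy y' hy' ((hmem _).2 ⟨n' - n, hsub⟩)
    refine ⟨hyy, ?_⟩
    subst hyy
    rw [sub_self, eq_comm, smul_eq_zero] at hsub
    rcases hsub with h1 | h1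
    · exact_mod_cast (sub_eq_zero.1 (by exact_mod_cast h1)).symm
    · exact absurd h1 hvne
  -- the kernel families `c x (y, n) = f(|x − y − n v|)` (an opaque local definition with its equation)
  obtain ⟨c, hcdef⟩ : ∃ c : EuclideanSpace ℝ (Fin 1) → (Q.motif × ℤ) → ℝ,
      c = fun x p => f (dist x (p.1.1 + (p.2 : ℝ) • v)) := ⟨_, rfl⟩
  -- (A) for a motif point `x`: `c x` is summable on `motif × ℤ` and `Σ' c x = f 0 + S(x)`
  have hA : ∀ x : Q.motif, Summable (c x.1) ∧
      ∑' p, c x.1 p = f 0 + ∑' z : {z : EuclideanSpace ℝ (Fin 1) // z ∈ Q.points ∧ z ≠ x.1},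
        f (dist x.1 z.1) := by
    intro x
    set b : Q.motif × ℤ := (x, 0) with hbdef
    -- the bijection `(y, n) ↦ y + n v` from `{p ≠ b}` onto the points `≠ x`
    have hmem_pts : ∀ p : Q.motif × ℤ, p.1.1 + (p.2 : ℝ) • v ∈ Q.points := fun p =>
      ⟨p.1.1, p.1.2, (p.2 : ℝ) • v, (hmem _).2 ⟨p.2, rfl⟩, rfl⟩
    have hxb : x.1 = b.1.1 + (b.2 : ℝ) • v := by simp [hbdef]
    have hne_pts : ∀ p : Q.motif × ℤ, p ≠ b → p.1.1 + (p.2 : ℝ) • v ≠ x.1 := by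
      intro p hp heq
      apply hp
      rw [hxb] at heq
      obtain ⟨h1, h2⟩ := huniq _ p.1.2 _ b.1.2 _ _ heq
      exact Prod.ext (Subtype.ext h1) h2
    set ex : {p : Q.motif × ℤ // p ≠ b} → {z : EuclideanSpace ℝ (Fin 1) // z ∈ Q.points ∧ z ≠ x.1} :=
      fun p => ⟨p.1.1.1 + (p.1.2 : ℝ) • v, hmem_pts p.1, hne_pts p.1 p.2⟩ with hexdef
    have hex_bij : Function.Bijective ex := by
      constructor
      · intro p q hpq
        have h := congrArg (fun z : {z : EuclideanSpace ℝ (Fin 1) // z ∈ Q.points ∧ z ≠ x.1} => z.1) hpq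
        simp only [hexdef] at h
        obtain ⟨h1, h2⟩ := huniq _ p.1.1.2 _ q.1.1.2 _ _ h
        exact Subtype.ext (Prod.ext (Subtype.ext h1) h2)
      · intro z
        obtain ⟨y, hy, g, hg, hz⟩ := z.2.1
        obtain ⟨n, rfl⟩ := (hmem g).1 hg
        have hp : ((⟨y, hy⟩, n) : Q.motif × ℤ) ≠ b := by
          intro hpb
          apply z.2.2
          rw [hz, hxb, ← hpb]
        exact ⟨⟨(⟨y, hy⟩, n), hp⟩, Subtype.ext (by simp [hexdef, hz])⟩
    set e := Equiv.ofBijective ex hex_bij with hedef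
    -- summability on `{p ≠ b}` and then on everything
    have hS := hsum x.1 (Q.mem_points_of_mem_motif x.2)
    have hsub : Summable (fun p : {p : Q.motif × ℤ // p ≠ b} => c x.1 p.1) := by
      have := (e.summable_iff.2 hS)
      refine this.congr fun p => ?_
      simp [hedef, hexdef, hcdef]
    have hcompl : Summable (fun p : ((({b} : Set (Q.motif × ℤ)))ᶜ : Set (Q.motif × ℤ)) => c x.1 p.1) := hsub
    have hsing : Summable (fun p : (({b} : Set (Q.motif × ℤ))) => c x.1 p.1) := Summable.of_finite
    have hfull : Summable (c x.1) := hsing.add_compl hcompl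
    refine ⟨hfull, ?_⟩
    -- the value: split off the point `b`
    rw [hfull.tsum_eq_add_tsum_ite b]
    have hcb : c x.1 b = f 0 := by simp [hcdef, hbdef]
    rw [hcb]
    congr 1
    -- `Σ' p, ite (p = b) 0 (c x p) = Σ' p : {p ≠ b}, c x p = S(x)`
    have h1 : ∑' p : Q.motif × ℤ, (if p = b then 0 else c x.1 p)
        = ∑' p : (({b} : Set (Q.motif × ℤ))ᶜ : Set (Q.motif × ℤ)), c x.1 p.1 := by
      rw [tsum_subtype]
      refine tsum_congr fun p => ?_
      rw [Set.indicator_apply]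
      by_cases hp : p = b
      · simp [hp]
      · rw [if_neg hp, if_pos (by simpa using hp)]
    rw [h1]
    have h2 := e.tsum_eq (fun z : {z : EuclideanSpace ℝ (Fin 1) // z ∈ Q.points ∧ z ≠ x.1} => f (dist x.1 z.1))
    rw [← h2]
    refine tsum_congr fun p => ?_
    simp [hedef, hexdef, hcdef]
  -- (B) the folded sequence `E d = Σ_{x,y} (c x (y,d) [+ c x (y,−d)])` is summable with `Σ' E = Σ_x Σ' c x`
  have hcy : ∀ x y : Q.motif, Summable (fun n : ℤ => c x.1 (y, n)) := fun x y => (hA x).1.prod_factor y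
  have hfold : ∀ x y : Q.motif, Summable (fun d : ℕ =>
      (if d = 0 then c x.1 (y, 0) else c x.1 (y, (d : ℤ)) + c x.1 (y, -(d : ℤ)))) :=
    fun x y => ppos_fold_summable (ψ := fun n : ℤ => c x.1 (y, n)) (hcy x y)
  have h3 : ∀ x : Q.motif, ∑' d : ℕ, ∑ y : Q.motif,
      (if d = 0 then c x.1 (y, 0) else c x.1 (y, (d : ℤ)) + c x.1 (y, -(d : ℤ)))
        = ∑' p : Q.motif × ℤ, c x.1 p := by
    intro x
    rw [Summable.tsum_finsetSum (fun y _ => hfold x y), (hA x).1.tsum_prod' (hcy x), tsum_fintype]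
    exact Finset.sum_congr rfl fun y _ => ppos_fold_tsum (ψ := fun n : ℤ => c x.1 (y, n)) (hcy x y)
  obtain ⟨E, hEdef⟩ : ∃ E : ℕ → ℝ, E = fun d : ℕ => ∑ x : Q.motif, ∑ y : Q.motif,
      (if d = 0 then c x.1 (y, 0) else c x.1 (y, (d : ℤ)) + c x.1 (y, -(d : ℤ))) := ⟨_, rfl⟩
  have hEapply : ∀ d : ℕ, E d = ∑ x : Q.motif, ∑ y : Q.motif,
      (if d = 0 then c x.1 (y, 0) else c x.1 (y, (d : ℤ)) + c x.1 (y, -(d : ℤ))) := fun d => by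
    rw [hEdef]
  have hEsum : Summable E := by
    rw [hEdef]
    exact summable_sum fun x _ => summable_sum fun y _ => hfold x y
  have hEtsum : ∑' d, E d = ∑ x : Q.motif, ∑' p : Q.motif × ℤ, c x.1 p := by
    rw [tsum_congr hEapply, Summable.tsum_finsetSum (fun x _ => summable_sum fun y _ => hfold x y)]
    exact Finset.sum_congr rfl fun x _ => h3 x
  -- (C) Gram sums on `K` periods: `Σ_{q,q'} f(|q − q'|) = Σ_{d<K} (K − d) E d`
  have hGram : ∀ K : ℕ, ∑ q : Q.motif × Fin K, ∑ q' : Q.motif × Fin K,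
      f (dist (q.1.1 + ((q.2 : ℕ) : ℝ) • v) (q'.1.1 + ((q'.2 : ℕ) : ℝ) • v))
        = ∑ d ∈ Finset.range K, ((K : ℝ) - d) * E d := by
    intro K
    -- the distance only depends on `j − i`
    have hdist : ∀ (x y : Q.motif) (i j : Fin K),
        f (dist (x.1 + ((i : ℕ) : ℝ) • v) (y.1 + ((j : ℕ) : ℝ) • v))
          = c x.1 (y, ((j : ℕ) : ℤ) - ((i : ℕ) : ℤ)) := by
      intro x y i j
      rw [hcdef]
      dsimp only
      congr 1
      rw [dist_eq_norm, dist_eq_norm]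
      congr 1
      push_cast
      rw [sub_smul]
      abel
    -- per pair `(x, y)`: the counting identity
    have h2 : ∀ x y : Q.motif, ∑ i : Fin K, ∑ j : Fin K, c x.1 (y, ((j : ℕ) : ℤ) - ((i : ℕ) : ℤ))
        = ∑ d ∈ Finset.range K, ((K : ℝ) - d) *
            (if d = 0 then c x.1 (y, 0) else c x.1 (y, (d : ℤ)) + c x.1 (y, -(d : ℤ))) :=
      fun x y => ppos_counting (fun n => c x.1 (y, n)) K
    calc ∑ q : Q.motif × Fin K, ∑ q' : Q.motif × Fin K,
          f (dist (q.1.1 + ((q.2 : ℕ) : ℝ) • v) (q'.1.1 + ((q'.2 : ℕ) : ℝ) • v))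
        = ∑ x : Q.motif, ∑ i : Fin K, ∑ y : Q.motif, ∑ j : Fin K,
            c x.1 (y, ((j : ℕ) : ℤ) - ((i : ℕ) : ℤ)) := by
          rw [Fintype.sum_prod_type]
          refine Finset.sum_congr rfl fun x _ => Finset.sum_congr rfl fun i _ => ?_
          rw [Fintype.sum_prod_type]
          exact Finset.sum_congr rfl fun y _ => Finset.sum_congr rfl fun j _ => hdist x y i j
      _ = ∑ x : Q.motif, ∑ y : Q.motif, ∑ i : Fin K, ∑ j : Fin K,
            c x.1 (y, ((j : ℕ) : ℤ) - ((i : ℕ) : ℤ)) :=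
          Finset.sum_congr rfl fun x _ => Finset.sum_comm
      _ = ∑ x : Q.motif, ∑ y : Q.motif, ∑ d ∈ Finset.range K, ((K : ℝ) - d) *
            (if d = 0 then c x.1 (y, 0) else c x.1 (y, (d : ℤ)) + c x.1 (y, -(d : ℤ))) :=
          Finset.sum_congr rfl fun x _ => Finset.sum_congr rfl fun y _ => h2 x y
      _ = ∑ x : Q.motif, ∑ d ∈ Finset.range K, ∑ y : Q.motif, ((K : ℝ) - d) *
            (if d = 0 then c x.1 (y, 0) else c x.1 (y, (d : ℤ)) + c x.1 (y, -(d : ℤ))) :=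
          Finset.sum_congr rfl fun x _ => Finset.sum_comm
      _ = ∑ d ∈ Finset.range K, ∑ x : Q.motif, ∑ y : Q.motif, ((K : ℝ) - d) *
            (if d = 0 then c x.1 (y, 0) else c x.1 (y, (d : ℤ)) + c x.1 (y, -(d : ℤ))) :=
          Finset.sum_comm
      _ = ∑ d ∈ Finset.range K, ((K : ℝ) - d) * E d := by
          refine Finset.sum_congr rfl fun d _ => ?_
          rw [hEapply, Finset.mul_sum]
          exact Finset.sum_congr rfl fun x _ => (Finset.mul_sum _ _ _).symm
  -- (D) the limit `Σ' E = Σ_x (f 0 + S x) = #motif·f 0 + Σ_x S x` of the Fejér means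
  have hval : ∑' d, E d = (Q.motif.card : ℝ) * f 0 + ∑ x ∈ Q.motif,
      ∑' z : {z : EuclideanSpace ℝ (Fin 1) // z ∈ Q.points ∧ z ≠ x}, f (dist x z.1) := by
    rw [hEtsum, Finset.sum_congr rfl fun x _ => (hA x).2, Finset.sum_add_distrib, Finset.sum_const,
      Finset.card_univ, Fintype.card_coe, nsmul_eq_mul,
      Finset.sum_coe_sort Q.motif (fun x => ∑' z : {z : EuclideanSpace ℝ (Fin 1) // z ∈ Q.points ∧ z ≠ x},
        f (dist x z.1))]
  rw [← hval]
  refine (stub_cesaro E hEsum).congr fun K => ?_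
  rw [hGram K]

/-- The interaction energy of the block of `K` cells, indexed through `Fin (#F·K) ≃ Fin #F × Fin K ≃ F × Fin K`,
is half the full unit-weight Gram sum over `F × Fin K`, for a pair potential with `V 0 = 0`. [folklore] -/
theorem ublockE_interactionEnergy_eq (Q : PeriodicConfiguration 1) (v : EuclideanSpace ℝ (Fin 1))
    (V : ℝ → ℝ) (hV : V 0 = 0) (K : ℕ) :
    interactionEnergy V (fun i : Fin (Q.motif.card * K) =>
        (((Q.motif.equivFin.symm (finProdFinEquiv.symm i).1 : Q.motif) : EuclideanSpace ℝ (Fin 1)) +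
          (((finProdFinEquiv.symm i).2 : ℕ) : ℝ) • v)) =
      (∑ q : Q.motif × Fin K, ∑ q' : Q.motif × Fin K,
        V (dist (q.1.1 + ((q.2 : ℕ) : ℝ) • v) (q'.1.1 + ((q'.2 : ℕ) : ℝ) • v))) / 2 := by
  rw [eq_div_iff (two_ne_zero' ℝ), mul_comm, two_mul_interactionEnergy_eq_sum_sum V hV]
  set e : Q.motif × Fin K ≃ Fin (Q.motif.card * K) :=
    (Q.motif.equivFin.prodCongr (Equiv.refl (Fin K))).trans finProdFinEquiv with he
  rw [← e.sum_comp]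
  refine Finset.sum_congr rfl fun q _ => ?_
  rw [← e.sum_comp]
  refine Finset.sum_congr rfl fun q' _ => ?_
  simp [he]

/-- **STUB `stub_blockEnergy1D`** (registered on stmt-AtomisticToContinuum-11959, Transfer skeleton VI): BLOCKS ARE
TRIAL STATES WITH `o(K)` SURFACE ENERGY.  For a periodic configuration `Q = F + ℤv` of the line, the Lennard-Jones
energy of the block of `K` cells (`#F·K` points `y + jv`, `y ∈ F`, `0 ≤ j < K`) is `#F·K·e_LJ(Q) + o(K)`:
`(E_LJ(block_K) − #F·K·e_LJ(Q))/K → 0` (unit-weight Gram sum `Σ_{d<K}(K−d)e_d`, Cesàro/Fejér means of the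
absolutely convergent series `Σ_d e_d = 2·#F·e(Q)`, as in `stub_periodicPosType1D`). [folklore] -/
theorem stub_blockEnergy1D : ∀ (Q : PeriodicConfiguration 1) (v : EuclideanSpace ℝ (Fin 1)),
    (∀ g : EuclideanSpace ℝ (Fin 1), g ∈ Q.lattice ↔ ∃ n : ℤ, g = n • v) →
    Filter.Tendsto (fun K : ℕ => (interactionEnergy lennardJones (fun i : Fin (Q.motif.card * K) => (((Q.motif.equivFin.symm (finProdFinEquiv.symm i).1 : Q.motif) : EuclideanSpace ℝ (Fin 1)) + (((finProdFinEquiv.symm i).2 : ℕ) : ℝ) • v))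
      - ((Q.motif.card * K : ℕ) : ℝ) * Q.energyPerParticle lennardJones) / K) Filter.atTop (nhds 0) := by
  intro Q v hv
  -- `v ≠ 0`: the lattice of periods has rank one
  have hvne : v ≠ 0 := by
    intro h0
    have hbot : Q.lattice = ⊥ := by
      rw [Submodule.eq_bot_iff]
      intro g hg
      obtain ⟨m, hm⟩ := (hv g).1 hg
      rw [hm, h0, smul_zero]
    have h1 := Q.finrank_lattice
    rw [hbot, finrank_bot] at h1
    exact zero_ne_one h1
  -- real scalars
  have hmem : ∀ g : EuclideanSpace ℝ (Fin 1), g ∈ Q.lattice ↔ ∃ n : ℤ, g = (n : ℝ) • v := by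
    intro g
    rw [hv g]
    simp only [Int.cast_smul_eq_zsmul]
  have hS : ∀ y : EuclideanSpace ℝ (Fin 1), y ∈ Q.points →
      Summable (fun z : {z : EuclideanSpace ℝ (Fin 1) // z ∈ Q.points ∧ z ≠ y} =>
        lennardJones (dist y z.1)) :=
    fun y _ => Q.summable_lennardJones_dist (by norm_num) y
  have hlim := ublockE_gram_tendsto Q lennardJones hvne hmem hS
  rw [lennardJones_zero, mul_zero, zero_add] at hlim
  set S := ∑ x ∈ Q.motif, ∑' z : {z : EuclideanSpace ℝ (Fin 1) // z ∈ Q.points ∧ z ≠ x},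
    lennardJones (dist x z.1) with hSdef
  have he : Q.energyPerParticle lennardJones = (2 * (Q.motif.card : ℝ))⁻¹ * S := rfl
  have hn : (Q.motif.card : ℝ) ≠ 0 := by exact_mod_cast Q.motif_nonempty.card_pos.ne'
  have h2 : Tendsto (fun K : ℕ => (1 / 2 : ℝ) * ((∑ q : Q.motif × Fin K, ∑ q' : Q.motif × Fin K,
      lennardJones (dist (q.1.1 + ((q.2 : ℕ) : ℝ) • v) (q'.1.1 + ((q'.2 : ℕ) : ℝ) • v))) / K - S))
      atTop (𝓝 ((1 / 2 : ℝ) * (S - S))) :=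
    (hlim.sub_const S).const_mul (1 / 2 : ℝ)
  rw [sub_self, mul_zero] at h2
  refine h2.congr' ?_
  filter_upwards [eventually_gt_atTop 0] with K hK
  have hK : (K : ℝ) ≠ 0 := by exact_mod_cast hK.ne'
  rw [ublockE_interactionEnergy_eq Q v lennardJones lennardJones_zero K, he]
  push_cast
  field_simp

end Summit.AtomisticToContinuum.Crystallization.Theorems.ThreeConeCertificateExactCertificate.Transfer1D

end
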